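import Mathlib.RingTheory.Regular.RegularSequence
import Literature.RingTheory.TightClosure.TightClosure
import Summits.ResolutionOfSingularities.ResolutionOfSingularities.Theorems.FrobeniusLadderFRationalModificationExchange
import HarnessLib

/-!
# Fedder–Watanabe deformation of tight closedness (crux `FrobeniusLadder.FRationalModification`)

Stub `stub_deformFW` of the skeleton `Sketch` for crux stmt-ResolutionOfSingularities-15316
(route `ResolutionOfSingularities/FrobeniusLadder`, rung 3: F-rational models) — Fedder–Watanabe
1989, Prop. 2.13 ("the five lines"). Let `(R, 𝔪)` be a Noetherian local domain of prime
characteristic `p` and dimension `d + 1` which is Cohen–Macaulay in the sense that every system of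
parameters is a weakly regular sequence (in the given order). Let `f ∈ R` and `s : Fin d → R` with
`rad (f, s) = 𝔪`, such that

* `R/fR` is F-injective at `s`, written upstairs: `y^q ∈ (f) + (s)^[q] ⇒ y ∈ (f, s)` (`q = p^e`);
* some power `fⁿ` is a parameter test element: `fⁿ · (s')^* ⊆ (s')` for every system of
  parameters `s'`.

Then the parameter ideal `(f, s)` is tightly closed.

Proof (the five lines). Replacing `n` by `n + 1` we may assume `n ≥ 1`; pick `q = p^e > n`. For
`y ∈ (f, s)^*` (witness `c ≠ 0`, `c y^{p^e'} ∈ (f, s)^[p^e']` for all `e'`) the same witness shows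
`y^q ∈ ((f, s)^[q])^*`, and `(f, s)^[q] = (f^q, s^q)` is again a parameter ideal, so the test
element gives `fⁿ y^q = a f^q + b` with `b ∈ (s)^[q] = (s^q)`. Hence
`fⁿ (y^q - a f^{q-n}) = b ∈ (s^q)`; as `(s^q, fⁿ)` is a system of parameters, hence weakly regular,
`fⁿ` is a non-zero-divisor modulo `(s^q)` (colon capturing), so `y^q - a f^{q-n} ∈ (s)^[q]` and
`y^q ∈ (f) + (s)^[q]`; F-injectivity gives `y ∈ (f, s)`.

Vocabulary: `Literature.RingTheory.TightClosure` (`frobeniusPower`, `tightClosure`,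
`IsTightlyClosed`, `IsSystemOfParameters`) and Mathlib's `RingTheory.Sequence.IsWeaklyRegular`.
The colon-capturing lemma (`a x ∈ (u) ⇒ x ∈ (u)` for a parameter ideal `(a, u)` when every system
of parameters is weakly regular) is reused from the sibling support file of stub `stub_exchange`
(`…Theorems.FRationalModification.Exchange.mem_span_of_mul_mem`); the remaining helper (radicals
of `(f^a, s^b)`) is elementary and proved here. No named facts.

Reference: R. Fedder, K.-i. Watanabe, *A characterization of F-regularity in terms of F-purity*,
in: Commutative Algebra (MSRI Publ. 15), Springer 1989, 227–245, Prop. 2.13.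
-/

-- single-problem summit: the doubled namespace component `ResolutionOfSingularities` is forced
set_option linter.dupNamespace false

namespace Summit.ResolutionOfSingularities.ResolutionOfSingularities.Theorems.FRationalModification.DeformFW

open IsLocalRing RingTheory.Sequence Literature.RingTheory.TightClosure

section Helpers

variable {R : Type*} [CommRing R]

/-- Raising the generators of `(f, s₁, …, s_d)` to positive powers does not change the radical:
`rad (f^a, s₁^b, …, s_d^b) = rad (f, s)` for `a, b ≥ 1`. [folklore] -/
theorem radical_span_insert_pow {d : ℕ} (f : R) (s : Fin d → R) {a b : ℕ} (ha : 0 < a)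
    (hb : 0 < b) :
    (Ideal.span (insert (f ^ a) (Set.range fun i => s i ^ b))).radical =
      (Ideal.span (insert f (Set.range s))).radical := by
  refine le_antisymm (Ideal.radical_le_radical_iff.mpr ?_) (Ideal.radical_le_radical_iff.mpr ?_)
  · rw [Ideal.span_le]
    rintro x hx
    rcases Set.mem_insert_iff.mp hx with rfl | ⟨i, rfl⟩
    · exact Ideal.le_radical (Ideal.pow_mem_of_mem _ (Ideal.subset_span (Set.mem_insert f _)) a ha)
    · exact Ideal.le_radical
        (Ideal.pow_mem_of_mem _ (Ideal.subset_span (Set.mem_insert_of_mem f (Set.mem_range_self i)))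
          b hb)
  · rw [Ideal.span_le]
    rintro x hx
    rcases Set.mem_insert_iff.mp hx with rfl | ⟨i, rfl⟩
    · exact ⟨a, Ideal.subset_span (Set.mem_insert _ _)⟩
    · exact ⟨b, Ideal.subset_span (Set.mem_insert_of_mem _ ⟨i, rfl⟩)⟩

end Helpers

/-- **Fedder–Watanabe 1989, Prop. 2.13 (the five lines)** — stub `stub_deformFW` of crux
`FRationalModification`, line `Sketch`: `(R, 𝔪)` a Noetherian local domain of characteristic `p` and
dimension `d + 1` in which every system of parameters is a weakly regular sequence (Cohen–Macaulay);
`f ∈ R` and `s : Fin d → R` with `(f, s)` a parameter ideal (`rad (f, s) = 𝔪`) such that `R/fR` is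
F-injective at `s`, written upstairs (`y^q ∈ (f) + (s)^[q] ⇒ y ∈ (f, s)`), and some power `fⁿ` is a
parameter test element (`fⁿ · (s')^* ⊆ (s')` for every system of parameters `s'`). Then `(f, s)` is
tightly closed: for `y ∈ (f, s)^*`, `y^q ∈ ((f, s)^[q])^*` with `(f, s)^[q] = (f^q, s^q)` a
parameter ideal, so `fⁿ y^q = a f^q + b`, `b ∈ (s)^[q]`; for `q > n ≥ 1`,
`fⁿ (y^q - a f^{q-n}) = b ∈ (s)^[q]` and `fⁿ` is regular modulo `(s)^[q]` (the system of parameters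
`s^q, fⁿ` is weakly regular), so `y^q ∈ (f) + (s)^[q]`, whence `y ∈ (f, s)` by F-injectivity.
[cite: FedderWatanabe1989, Prop. 2.13] -/
theorem stub_deformFW (p : ℕ) [Fact p.Prime] {R : Type*} [CommRing R] [IsDomain R]
    [IsNoetherianRing R] [IsLocalRing R] [CharP R p]
    (hCM : ∀ ⦃n : ℕ⦄ (s : Fin n → R), IsSystemOfParameters s → IsWeaklyRegular R (List.ofFn s))
    {d : ℕ} (hd : ringKrullDim R = ((d + 1 : ℕ) : WithBot ℕ∞)) {f : R} {s : Fin d → R}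
    (hs : (Ideal.span (insert f (Set.range s))).radical = maximalIdeal R)
    (hFinj : ∀ (y : R) (e : ℕ),
      y ^ p ^ e ∈ Ideal.span {f} ⊔ frobeniusPower (p ^ e) (Ideal.span (Set.range s)) →
        y ∈ Ideal.span (insert f (Set.range s)))
    (htest : ∃ n : ℕ, ∀ ⦃m : ℕ⦄ (s' : Fin m → R), IsSystemOfParameters s' →
      ∀ y ∈ tightClosure p (Ideal.span (Set.range s')), f ^ n * y ∈ Ideal.span (Set.range s')) :
    IsTightlyClosed p (Ideal.span (insert f (Set.range s))) := by
  have hp : p.Prime := Fact.out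
  -- (0) a test exponent `n ≥ 1`
  obtain ⟨n, hn, htest'⟩ : ∃ n : ℕ, 0 < n ∧ ∀ ⦃m : ℕ⦄ (s' : Fin m → R), IsSystemOfParameters s' →
      ∀ y ∈ tightClosure p (Ideal.span (Set.range s')), f ^ n * y ∈ Ideal.span (Set.range s') := by
    obtain ⟨n₀, hn₀⟩ := htest
    refine ⟨n₀ + 1, n₀.succ_pos, fun m s' hs' y hy => ?_⟩
    rw [pow_succ', mul_assoc]
    exact Ideal.mul_mem_left _ f (hn₀ s' hs' y hy)
  -- `q = p ^ e > n`, `q = n + k + 1`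
  obtain ⟨e, hne⟩ : ∃ e : ℕ, n < p ^ e := ⟨n, Nat.lt_pow_self hp.one_lt⟩
  obtain ⟨k, hk⟩ := Nat.exists_eq_add_of_lt hne
  have hq : 0 < p ^ e := pow_pos hp.pos e
  rw [isTightlyClosed_iff_le]
  intro y hy
  obtain ⟨c, hc, hcy⟩ := (mem_tightClosure_iff_of_isDomain p).mp hy
  -- (i) `y^q ∈ ((f, s)^[q])^*`, with the same witness `c`
  have hyq : y ^ p ^ e ∈
      tightClosure p (frobeniusPower (p ^ e) (Ideal.span (insert f (Set.range s)))) := by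
    refine (mem_tightClosure_iff_of_isDomain p).mpr ⟨c, hc, fun e' => ?_⟩
    rw [frobeniusPower_frobeniusPower, ← pow_mul, ← pow_add]
    exact hcy (e + e')
  -- (ii) `(f, s)^[q] = (f^q, s^q)` is a parameter ideal; apply the test element `fⁿ`
  have hsq : frobeniusPower (p ^ e) (Ideal.span (Set.range s)) =
      Ideal.span (Set.range fun i => s i ^ p ^ e) := by
    rw [frobeniusPower_span, ← Set.range_comp]
    rfl
  have hIq : frobeniusPower (p ^ e) (Ideal.span (insert f (Set.range s))) =
      Ideal.span (Set.range (Fin.cons (f ^ p ^ e) (fun i => s i ^ p ^ e) : Fin (d + 1) → R)) := by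
    rw [Fin.range_cons, frobeniusPower_span, Set.image_insert_eq, ← Set.range_comp]
    rfl
  have hu :
      IsSystemOfParameters (Fin.cons (f ^ p ^ e) (fun i => s i ^ p ^ e) : Fin (d + 1) → R) := by
    refine ⟨hd, ?_⟩
    rw [Fin.range_cons, radical_span_insert_pow f s hq hq, hs]
  have h2 := htest' _ hu (y ^ p ^ e) (by rwa [← hIq])
  rw [Fin.range_cons, Ideal.mem_span_insert] at h2
  obtain ⟨a, b, hb, hab⟩ := h2
  -- (iii) `fⁿ (y^q - a f^(q-n)) = b ∈ (s^q)`
  have hfq : f ^ p ^ e = f ^ n * f ^ (k + 1) := by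
    rw [hk, add_assoc, pow_add]
  have hz : f ^ n * (y ^ p ^ e - a * f ^ (k + 1)) = b := by
    rw [mul_sub, hab, hfq]
    ring
  -- (iv) colon capturing: `fⁿ` is regular modulo `(s^q)` as `(s^q, fⁿ)` is a weakly regular s.o.p.
  have hw : (Ideal.span (insert (f ^ n) (Set.range fun i => s i ^ p ^ e))).radical =
      maximalIdeal R := by
    rw [radical_span_insert_pow f s hn hq, hs]
  have hzmem : y ^ p ^ e - a * f ^ (k + 1) ∈ Ideal.span (Set.range fun i => s i ^ p ^ e) :=
    Exchange.mem_span_of_mul_mem hCM hd hw (by rw [hz]; exact hb)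
  -- (v) `y^q ∈ (f) + (s)^[q]`, so `y ∈ (f, s)` by F-injectivity
  refine hFinj y e ?_
  have hy_eq : y ^ p ^ e = a * f ^ k * f + (y ^ p ^ e - a * f ^ (k + 1)) := by ring
  rw [hy_eq, hsq]
  exact Submodule.add_mem_sup (Ideal.mul_mem_left _ _ (Ideal.mem_span_singleton_self f)) hzmem

end Summit.ResolutionOfSingularities.ResolutionOfSingularities.Theorems.FRationalModification.DeformFW
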